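import Literature.MathematicalPhysics.QuantumFieldTheory.Balaban1983to89.Node00.TorusCoverCubeDomains
import Literature.MathematicalPhysics.QuantumFieldTheory.Balaban1983to89.B6SectAOperatorsV1
import Literature.MathematicalPhysics.QuantumFieldTheory.Balaban1983to89.T4AxialGaugeSmallField
import HarnessLib

/-!
# N07 [B11] (= [15] = [Balaban1985Variational]) Sect. F, road of record R0′, S6 HEAD: **THE THREE BOX-MEMBERSHIP FACTS OF THE (r2) DOOR,
# SUPPLIED** — for any nested family whose positive levels sit in per-level label boxes, and at the head's family `Node00.cubeDomains`
# ([6] (1.131) cube tower) with its CANONICAL LEVEL BOXES and their widths in closed form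

Cell `pub-ymgap`, width seat `pub-ymgap-dag-n07-w4` g4 (sub-target S6 = the HEAD of [15] Sect. F's one-step improvement at NODE 00's objects), CLAIM-1 ∕
INTENT-1 (cell bus I.36164).  `--kind proof --supports stmt-QuantumFields-27364 --as helper` (K1⁹ per dag-lead KEY MAP v2 ∕ GATE v1.69); count-neutral; def-free.
[15] = T. Bałaban, Commun. Math. Phys. **102** (1985) 277–309 [Balaban1985Variational]; [6] = [Balaban1985RegularSpaces] (CMP **99** (1985) 75–102); [4] =
[Balaban1984PropagatorsII] (CMP **96** (1984) 223–250); [I.4] = [Balaban1984PropagatorsI] (CMP **95** (1984) 17–40); [I] = [Balaban1987RG1].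

THE POINT.  dag-n07-w8's record edition of the S6 head's R0′ split clause, `N07SplitClauseOfShearSize.localGaugeSplitOn_of_gauge152_recordShear_adm22_T4`
(p625131; and its sign-free twin, FILE 8), DISPLAYS three GEOMETRIC binders about an admissible nested family `D` ([4] (2.1)–(2.3)) and per-level label boxes
`[lo_j, hi_j] ⊂ ℤᵈ`: (O) every OUTER end-point of a `Λ_j`-bond (an end-point outside `Ω_j^{(j)}`) lies in `π_j[lo_j, hi_j]`; (S) every `Λ_j`-site, `j ≥ 1`, lies in
`π_j[lo_j, hi_j]`; (0) every fine site UNDER an outer end-point lies in `π[lo_0, hi_0]` — «the head's window ∕ collar geometry».  For the head's per-datum family — the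
torus family `Node00.cubeDomains P a M ρ k` of the datum's own (1.131) tower `{□_j}` (n07-e module 39; [15] (144) p. 300) — the positive levels ARE covered label boxes,
`Ω_j^{(j)} = π_j[sqLo_j, sqHi_j]` (`1 ≤ j ≤ k`), so all three facts are lattice bookkeeping: a positively oriented bond with one end in a covered box has its other end in the
box widened by one label (`castSite (z ± e_μ) = castSite z ± e_μ` — NO non-wrapping hypothesis), and a fine site under a level-`j` label `s` lifts to the `ℤᵈ` block of `s`
(`image_cover_blockSites`, standing range only), whose coordinates lie in `[L^j s, L^j s + L^j − 1]`.  With the CANONICAL boxes `lo_j = sqLo_j − 𝟙`, `hi_j = sqHi_j + 𝟙`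
(`j ≥ 1`) and `lo_0 = L·(sqLo_1 − 𝟙)`, `hi_0 = L·(sqHi_1 + 𝟙) + (L − 1)𝟙`, fact (0) at the levels `j ≥ 2` needs the one-label overhang `L^j` to fit inside `□_1`'s fine collar
`ρ(L + … + L^{j−1})` over `□_j` ([6] p. 98) — true under the head's standing collar `L ≤ ρ` (dag-n07-w4 g3 `localLetters165Core_of_datumGauge165Core`).  The box widths
`D_j := Σ_κ (hi_{j,κ} − lo_{j,κ})` of n07-w8's binder `D_j·(v_j + a_j) ≤ σ` come out in closed form, `≤ d·(M + 4ρ + 3)·L^{k−j}` (the lineage's located (166♭) factor).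

WHAT IS PROVED (sorry-free; no definition; axioms standard; every `Params`).  §1 (torus plumbing) `castSite_sub_e`, `src_eq_castSite_sub_e` ∕ `tgt_eq_castSite_add_e`
(the other end of a bond with one labelled end), ★ `exists_lift_of_iterBlockOf_eq` (a fine site under `π_j s` lifts to the `ℤᵈ` block of `s`), `bounds_of_blockMap_eq`.
§2 (ANY nested family `D` with boxed positive levels `Ω_j^{(j)} ⊆ π_j[ilo_j, ihi_j]`, `1 ≤ j`) ★ `lamSite_mem_image_of_boxed` (S), ★★ `outer_mem_image_widened_of_boxed` (O,
boxes widened by one label), ★★ `under_outer_mem_image_of_boxed` (0, for every fine box containing `[L^j(ilo_j − 𝟙), L^j(ihi_j + 𝟙) + (L^j − 1)𝟙]` at the bond's level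
`j` — no `Λ₀` hypothesis needed).  §3 (AT `cubeDomains P a M ρ k`) `Om_cubeDomains_boxed`, the collar arithmetic `margin_add_pow_le_margin_one_add` (`L^jρ·gs(k−j) + L^j ≤
Lρ·gs(k−1) + L`, `1 ≤ j ≤ k`, `L ≤ ρ`) and its corner forms `levelBox_zero_corners_le`; ★★★ `levelBoxes_of_Om_subset_cubeDomains` (the three binders of p625131 §3
VERBATIM, for EVERY family levelwise inside the cube family — so the boundary datums' meet family gets them by `Ω″_j ⊆ Ω_j` — at the canonical boxes, keyed by four
equation binders on `lo`∕`hi`); ★★★ `levelBoxes_cubeDomains` (the cube family itself); `toNat_width_levelBox_pos ∕ _zero` (closed forms of `D_j`) and ★ `width_levelBox_le`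
(`D_j ≤ d·(M + 4ρ + 3)·L^{k−j}`, all `j ≤ k`, `1 ≤ k`).
HONEST SCOPE.  Count-neutral lattice-geometric bookkeeping on the torus cover (blocks, label boxes, one-step shifts); NO estimate; nothing of [15]∕[6]∕[4]∕[I.4] ANALYSIS
asserted; the letters `v_j, a_j`, `σ`, S3's gauge and (152) letters, the (159)-splitting stay DISPLAYED in n07-w8's door; `LocalLettersSplitTopStepCore(G∕R)` ∕
`DatumGaugeSplitTopStepCore(G∕R)` ∕ `HalvingStepTop(Core)` ∕ `stub_prop8StepCoP13` NOT discharged; K0⁷ ∕ K1⁹ NOT closed; N07 NOT discharged; counts unmoved (typed 28∕28 ·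
discharged 5∕27); one finite 𝕋⁴ programme at fixed ε — the route closes the conditional finite-𝕋⁴ rung `BalabanLadder.UV` ONLY; the YM mass gap (Clay) is NOT proved by any of
this; nothing continuum ∕ ℝ⁴ ∕ OS.  No `sorry`, no `def`, no `instance`, no `notation`.
RELATED IN THE TREE, NOT DUPLICATED (stem check 2026-08-28T10:41Z: `ls …/Theorems | rg -i 'LevelBox|BoxesCubeDomains|SplitClauseBoxes'` = ∅): n07-w8 `N07SplitClauseOfShearSize`
§1 `iterBlockOf_levOf_mem_of_lamSite` (plumbing FROM the three binders — CONSUMER side; this file is the SUPPLIER side); n07-e module 39 `Node00.TorusCoverCubeDomains`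
(`cubeDomains`, `mem_cubeDomains_Om_iff`, `cubeDomains_Om_of_lt`, `under_iff_blockMap_eq` — CONSUMED BY NAME); module 38 `Node00.TorusCoverLevels` (`image_cover_blockSites`
— CONSUMED); `T4AxialGaugeSmallField.castSite_add_e` (CONSUMED; its backward twin is §1 here); dag-n07-w4 g0 `Node00.TorusCoverBoxStencils` §3 (window facts at level `0`
WITH non-wrapping — lifting INTO a given box; here the box is widened instead, no injectivity); n05-a `B8Eq131Cubes` (`sqLo`, `sqHi`, `gs`, `margin_succ∕_anti` — CONSUMED).

References: [15] (144) p. 300, (150)–(152) p. 301, (164)–(165) p. 304; [6] (1.131) p. 99, p. 98; [4] (2.1)–(2.4) p. 224; [I.4] (1.18)–(1.20) p. 20; [I] (0.1) p. 251.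
-/

set_option autoImplicit false

noncomputable section
open scoped BigOperators

namespace Summit.QuantumFields.YangMills.BalabanUVNodes.N07SplitClauseBoxesCubeDomains

open Literature.MathematicalPhysics.QuantumFieldTheory.Balaban1983to89
open Literature.MathematicalPhysics.QuantumFieldTheory.Balaban1983to89.Node00
open B15Eq112TorusCover (cover)
open B14DomainGeom (Pt)
open B5Eq118OneStroke (iterBlockOf iterBlock mem_iterBlock)
open B7Prop1Explicit (e e_apply)
open B7Prop1Local (InBox)
open B8Eq131Cubes (sqLo sqHi bLo bHi gs gs_succ margin_succ margin_anti)
open B8Ineq132 (Under geom_margin)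
open B6SectADomainsV1 (Domains)
open B6SectAOperatorsV1 (BondIdx)
open T4AxialGaugeSmallField (castSite castSite_apply castSite_add_e)
open Literature.MathematicalPhysics.QuantumLattice (blockMap blockSites mem_blockSites_iff)

variable {P : Params}

/-! ## §1  Torus plumbing: one-step shifts of labelled sites; the lift of a fine site under a labelled level-`j` site -/

section Plumbing

/-- `(x + e_μ) − e_μ = x` on any torus `T^{(j)}`. [folklore] -/
private theorem unshift_shift {j : ℕ} (x : Site P j) (μ : Fin P.d) : (x.shift μ).unshift μ = x := by
  funext κ
  simp only [Site.shift, Site.unshift, Function.update_apply]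
  split_ifs with h
  · subst h; simp
  · rfl

/-- One backward lattice step commutes with the projection: `castSite (z − e_μ) = (castSite z) − e_μ` on the torus (twin of `T4AxialGaugeSmallField.castSite_add_e`).
[cite: Balaban1987RG1, (0.1) p.251 (bookkeeping on the torus)] -/
theorem castSite_sub_e {j : ℕ} (z : Pt P.d) (μ : Fin P.d) : (castSite (z - e μ) : Site P j) = (castSite z).unshift μ := by
  funext κ
  simp only [castSite_apply, Site.unshift, Function.update_apply, Pi.sub_apply, e_apply]
  split_ifs with h
  · subst h; simp only [Int.cast_sub, Int.cast_one]
  · simp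

/-- A positively oriented bond whose FINAL point is the labelled site `π_j s` starts at `π_j (s − e_μ)`. [cite: Balaban1987RG1, (0.1) p.251 (bookkeeping)] -/
theorem src_eq_castSite_sub_e {j : ℕ} (b : PBond P j) {s : Pt P.d} (h : b.tgt = castSite s) : b.src = castSite (s - e b.dir) := by
  rw [castSite_sub_e, ← h, PBond.tgt, unshift_shift]

/-- A positively oriented bond whose INITIAL point is the labelled site `π_j s` ends at `π_j (s + e_μ)`. [cite: Balaban1987RG1, (0.1) p.251 (bookkeeping)] -/
theorem tgt_eq_castSite_add_e {j : ℕ} (b : PBond P j) {s : Pt P.d} (h : b.src = castSite s) : b.tgt = castSite (s + e b.dir) := by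
  rw [castSite_add_e, ← h]; rfl

/-- ★ **A FINE SITE UNDER A LABELLED LEVEL-`j` SITE LIFTS TO THE `ℤᵈ` BLOCK OF THE LABEL** (standing range `j ≤ m + K`): if the `j`-fold block point of `x ∈ T_η` is
`π_j s`, then `x = π X` for some `X ∈ ℤᵈ` with `⌊X ∕ L^j⌋ = s` — module 38's «the `ℤᵈ` block covers the torus block exactly» read backwards.
[cite: Balaban1984PropagatorsI, (1.18) p.20; Balaban1987RG1, (0.1) p.251] -/
theorem exists_lift_of_iterBlockOf_eq {j : ℕ} (hj : j ≤ P.m + P.K) {x : Site P 0} {s : Pt P.d} (h : iterBlockOf j x = castSite s) :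
    ∃ X : Pt P.d, blockMap (P.L ^ j) X = s ∧ cover P X = x := by
  haveI : NeZero (P.L ^ j) := ⟨(pow_pos P.L_pos j).ne'⟩
  have hx : x ∈ iterBlock j (coverAt P j s) := (mem_iterBlock j _ x).2 h
  rw [← image_cover_blockSites hj s, Finset.mem_image] at hx
  obtain ⟨X, hX, hXx⟩ := hx
  exact ⟨X, (mem_blockSites_iff _ _ _).1 hX, hXx⟩

/-- The coordinates of a point of the `ℤᵈ` block of the level-`j` label `s`: `L^j s_i ≤ X_i ≤ L^j s_i + L^j − 1`. [cite: Balaban1985RegularSpaces, (1.4) p.77 («Ω_j = Bʲ(Ω_j^{(j)})»)] -/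
theorem bounds_of_blockMap_eq {j : ℕ} {X s : Pt P.d} (h : blockMap (P.L ^ j) X = s) (i : Fin P.d) :
    (P.L : ℤ) ^ j * s i ≤ X i ∧ X i ≤ (P.L : ℤ) ^ j * s i + ((P.L : ℤ) ^ j - 1) := by
  have hU : Under P.L j s X := (under_iff_blockMap_eq j s X).2 h
  obtain ⟨h1, h2⟩ := hU i
  exact ⟨h1, by linarith⟩

end Plumbing

/-! ## §2  Any nested family with boxed positive levels: the three facts -/

section Boxed

variable (D : Domains P) {ilo ihi : ℕ → Pt P.d}

/-- An end-point outside `Ω_j^{(j)}` forces `1 ≤ j` (at level `0` nothing is outside `Ω₀ = T`). [cite: Balaban1984PropagatorsII, (2.1) p.224 (the typed `Ω₀ := T`)] -/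
theorem one_le_of_not_mem_Om {j : ℕ} {y : Site P j} (h : y ∉ D.Om j) : 1 ≤ j := by
  rcases Nat.eq_zero_or_pos j with rfl | hj
  · exact absurd (by rw [D.Om_zero]; exact Finset.mem_univ _) h
  · exact hj

/-- ★ **(S) `Λ_j`-SITES LIE IN THE LEVEL BOX** (`j ≥ 1`): if `Ω_j^{(j)} ⊆ π_j[ilo_j, ihi_j]` for `1 ≤ j`, then every `Λ_j`-site lies in `π_j[lo_j, hi_j]` for any
`lo_j ≤ ilo_j`, `ihi_j ≤ hi_j` (`1 ≤ j ≤ k`) — `Λ_j ⊆ Ω_j^{(j)}` ([4] (2.3)). [cite: Balaban1984PropagatorsII, (2.3) p.224; Balaban1985Variational, (144) p.300] -/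
theorem lamSite_mem_image_of_boxed
    (hΩ : ∀ j, 1 ≤ j → ∀ y ∈ D.Om j, y ∈ (castSite '' Set.Icc (ilo j) (ihi j) : Set (Site P j)))
    {lo hi : ℕ → Pt P.d} (hlo : ∀ j, 1 ≤ j → j ≤ D.k → lo j ≤ ilo j) (hhi : ∀ j, 1 ≤ j → j ≤ D.k → ihi j ≤ hi j) :
    ∀ (j : ℕ), 1 ≤ j → ∀ y : Site P j, D.LamSite j y → y ∈ (castSite '' Set.Icc (lo j) (hi j) : Set (Site P j)) := by
  intro j hj y hy
  have hjk : j ≤ D.k := D.le_of_lamSite hy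
  obtain ⟨s, ⟨hs1, hs2⟩, rfl⟩ := hΩ j hj y hy.1
  exact ⟨s, ⟨(hlo j hj hjk).trans hs1, hs2.trans (hhi j hj hjk)⟩, rfl⟩

/-- ★★ **(O) OUTER END-POINTS OF `Λ_j`-BONDS LIE IN THE LEVEL BOX WIDENED BY ONE LABEL**: if `Ω_j^{(j)} ⊆ π_j[ilo_j, ihi_j]` (`1 ≤ j`), an end-point of a `Λ_j`-bond outside
`Ω_j^{(j)}` is `π_j s′` with `ilo_j − 𝟙 ≤ s′ ≤ ihi_j + 𝟙` — the inner end is `π_j s`, `s` in the box, and the bond is one positively oriented step ([4] p. 224 «Ω also the set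
of bonds ⋃_{x∈Ω} st(x)»); n07-w8's binder `hboxO`, any family. [cite: Balaban1984PropagatorsII, (2.3) p.224; Balaban1985Variational, (144) p.300, (150) p.301] -/
theorem outer_mem_image_widened_of_boxed
    (hΩ : ∀ j, 1 ≤ j → ∀ y ∈ D.Om j, y ∈ (castSite '' Set.Icc (ilo j) (ihi j) : Set (Site P j))) (c : BondIdx D) :
    (c.1.2.src ∉ D.Om c.1.1 → c.1.2.src ∈ (castSite '' Set.Icc (ilo c.1.1 - 1) (ihi c.1.1 + 1) : Set (Site P c.1.1))) ∧
    (c.1.2.tgt ∉ D.Om c.1.1 → c.1.2.tgt ∈ (castSite '' Set.Icc (ilo c.1.1 - 1) (ihi c.1.1 + 1) : Set (Site P c.1.1))) := by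
  obtain ⟨⟨j, b⟩, hb⟩ := c
  have h01 : ∀ (μ i : Fin P.d), (0 : ℤ) ≤ e μ i ∧ e μ i ≤ 1 := fun μ i => by
    rw [e_apply]; split_ifs <;> simp
  constructor
  · intro hsrc
    have hj : 1 ≤ (j : ℕ) := one_le_of_not_mem_Om D hsrc
    have htgt : b.tgt ∈ D.Om j := hb.1.resolve_left hsrc
    obtain ⟨s, ⟨hs1, hs2⟩, hse⟩ := hΩ j hj b.tgt htgt
    refine ⟨s - e b.dir, ⟨fun i => ?_, fun i => ?_⟩, (src_eq_castSite_sub_e b hse.symm).symm⟩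
    · have := hs1 i; have := (h01 b.dir i).2
      simp only [Pi.sub_apply, Pi.one_apply]; linarith
    · have := hs2 i; have := (h01 b.dir i).1
      simp only [Pi.sub_apply, Pi.add_apply, Pi.one_apply]; linarith
  · intro htgt
    have hj : 1 ≤ (j : ℕ) := one_le_of_not_mem_Om D htgt
    have hsrc : b.src ∈ D.Om j := hb.1.resolve_right htgt
    obtain ⟨s, ⟨hs1, hs2⟩, hse⟩ := hΩ j hj b.src hsrc
    refine ⟨s + e b.dir, ⟨fun i => ?_, fun i => ?_⟩, (tgt_eq_castSite_add_e b hse.symm).symm⟩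
    · have := hs1 i; have := (h01 b.dir i).1
      simp only [Pi.sub_apply, Pi.add_apply, Pi.one_apply]; linarith
    · have := hs2 i; have := (h01 b.dir i).2
      simp only [Pi.add_apply, Pi.one_apply]; linarith

/-- ★★ **(0) FINE SITES UNDER AN OUTER END-POINT LIE IN THE LEVEL-`0` BOX**: if `Ω_j^{(j)} ⊆ π_j[ilo_j, ihi_j]` (`1 ≤ j`) and, at the level `j` of the `Λ_j`-bond
`c`, the fine box `[lo_0, hi_0]` contains `[L^j(ilo_j − 𝟙), L^j(ihi_j + 𝟙) + (L^j − 1)𝟙]`, then every fine site `x` whose `j`-fold block point is an outer end-point of `c`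
lies in `π[lo_0, hi_0]` (the outer end-point is `π_j s′` with `s′ ∈ [ilo_j − 𝟙, ihi_j + 𝟙]`; `x` lifts to the `ℤᵈ` block of `s′`) — n07-w8's binder `hbox0` WITHOUT its
`Λ₀` hypothesis, any family. [cite: Balaban1984PropagatorsII, (2.2)–(2.4) p.224; Balaban1984PropagatorsI, (1.18)–(1.20) p.20; Balaban1985Variational, (144) p.300] -/
theorem under_outer_mem_image_of_boxed
    (hΩ : ∀ j, 1 ≤ j → ∀ y ∈ D.Om j, y ∈ (castSite '' Set.Icc (ilo j) (ihi j) : Set (Site P j)))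
    {lo hi : ℕ → Pt P.d} (c : BondIdx D)
    (h0lo : ∀ i, lo 0 i ≤ (P.L : ℤ) ^ (c.1.1 : ℕ) * (ilo c.1.1 i - 1))
    (h0hi : ∀ i, (P.L : ℤ) ^ (c.1.1 : ℕ) * (ihi c.1.1 i + 1) + ((P.L : ℤ) ^ (c.1.1 : ℕ) - 1) ≤ hi 0 i)
    (x : Site P 0)
    (hx : (c.1.2.src ∉ D.Om c.1.1 ∧ iterBlockOf c.1.1 x = c.1.2.src) ∨ (c.1.2.tgt ∉ D.Om c.1.1 ∧ iterBlockOf c.1.1 x = c.1.2.tgt)) :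
    x ∈ (castSite '' Set.Icc (lo 0) (hi 0) : Set (Site P 0)) := by
  have hjm : (c.1.1 : ℕ) ≤ P.m + P.K := (D.le_of_lamBond c.2).trans D.hk
  have hw := outer_mem_image_widened_of_boxed D hΩ c
  -- the outer end-point `π_j s′`, `s′ ∈ [ilo_j − 𝟙, ihi_j + 𝟙]`, with `x` under it
  obtain ⟨s', ⟨hs1, hs2⟩, hxs⟩ : ∃ s', s' ∈ Set.Icc (ilo c.1.1 - 1) (ihi c.1.1 + 1) ∧ iterBlockOf c.1.1 x = castSite s' := by
    rcases hx with ⟨hout, hxe⟩ | ⟨hout, hxe⟩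
    · exact (hw.1 hout).imp fun s' h => ⟨h.1, hxe.trans h.2.symm⟩
    · exact (hw.2 hout).imp fun s' h => ⟨h.1, hxe.trans h.2.symm⟩
  obtain ⟨X, hXs, hXx⟩ := exists_lift_of_iterBlockOf_eq hjm hxs
  have hL : (0 : ℤ) < (P.L : ℤ) ^ (c.1.1 : ℕ) := pow_pos (by exact_mod_cast P.L_pos) _
  refine ⟨X, ⟨fun i => ?_, fun i => ?_⟩, hXx⟩
  · have hb := (bounds_of_blockMap_eq hXs i).1
    have h1 : ilo c.1.1 i - 1 ≤ s' i := by simpa using hs1 i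
    nlinarith [h0lo i]
  · have hb := (bounds_of_blockMap_eq hXs i).2
    have h1 : s' i ≤ ihi c.1.1 i + 1 := by simpa using hs2 i
    nlinarith [h0hi i]

end Boxed

/-! ## §3  At the head's family `Node00.cubeDomains P a M ρ k` ([6] (1.131) tower): canonical level boxes, the three binders verbatim, widths -/

section Cube

variable {a : Pt P.d} {M ρ k : ℕ} {hk : k ≤ P.m + P.K}

/-- **THE POSITIVE LEVELS OF THE CUBE FAMILY ARE BOXED BY `[sqLo_j, sqHi_j]`**: `Ω_j^{(j)} = π_j[sqLo_j, sqHi_j]` for `1 ≤ j ≤ k` and `∅` above `k` (module 39).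
[cite: Balaban1985RegularSpaces, (1.131) p.99; Balaban1985Variational, (144) p.300] -/
theorem Om_cubeDomains_boxed :
    ∀ j, 1 ≤ j → ∀ y ∈ (cubeDomains P a M ρ k hk).Om j,
      y ∈ (castSite '' Set.Icc (sqLo P.L a ρ k j) (sqHi P.L a M ρ k j) : Set (Site P j)) := by
  intro j hj y hy
  by_cases hjk : j ≤ k
  · obtain ⟨s, hs, rfl⟩ := (mem_cubeDomains_Om_iff hj hjk y).1 hy
    exact ⟨s, ⟨fun i => (hs i).1, fun i => (hs i).2⟩, rfl⟩
  · rw [cubeDomains_Om_of_lt (not_le.mp hjk)] at hy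
    exact absurd hy (Finset.notMem_empty _)

/-- A family levelwise inside the cube family has boxed positive levels as well (e.g. the meet family of a boundary datum, `Ω″_j ⊆ Ω_j`).
[cite: Balaban1985Variational, (150) p.301 («Ω′_j = □_j for j < k, Ω′_k = □″_k»); Balaban1985RegularSpaces, (1.131) p.99] -/
theorem Om_boxed_of_subset_cubeDomains (D : Domains P) (hD : ∀ j, 1 ≤ j → D.Om j ⊆ (cubeDomains P a M ρ k hk).Om j) :
    ∀ j, 1 ≤ j → ∀ y ∈ D.Om j, y ∈ (castSite '' Set.Icc (sqLo P.L a ρ k j) (sqHi P.L a M ρ k j) : Set (Site P j)) :=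
  fun j hj y hy => Om_cubeDomains_boxed j hj y (hD j hj hy)

/-- A level of a family levelwise inside the cube family that carries a site is `≤ k` (above `k` the cube family is empty).
[cite: Balaban1985RegularSpaces, (1.131) p.99; Balaban1984PropagatorsII, (2.1) p.224] -/
theorem level_le_of_mem_Om_of_subset_cubeDomains (D : Domains P) (hD : ∀ j, 1 ≤ j → D.Om j ⊆ (cubeDomains P a M ρ k hk).Om j)
    {j : ℕ} (hj : 1 ≤ j) {y : Site P j} (hy : y ∈ D.Om j) : j ≤ k := by
  by_contra hjk
  have h := hD j hj hy
  rw [cubeDomains_Om_of_lt (not_le.mp hjk)] at h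
  exact absurd h (Finset.notMem_empty _)

/-- **THE COLLAR ARITHMETIC of fact (0)**: for `1 ≤ j ≤ k` and `L ≤ ρ`, `L^j·ρ·gs L (k−j) + L^j ≤ L·ρ·gs L (k−1) + L` — the fine margins `m_j = ρ(L^j + … + L^k)` of the
tower satisfy `m_1 − m_j = ρ(L + … + L^{j−1}) ≥ ρL^{j−1} ≥ L^j` for `j ≥ 2` ([6] p. 98 «a distance between boundaries of these cubes is equal to R₁M₁Lʲη»).
[cite: Balaban1985RegularSpaces, p.98 (display before (1.128)), (1.131) p.99] -/
theorem margin_add_pow_le_margin_one_add (hLρ : P.L ≤ ρ) {j : ℕ} (hj : 1 ≤ j) (hjk : j ≤ k) :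
    P.L ^ j * (ρ * gs P.L (k - j)) + P.L ^ j ≤ P.L ^ 1 * (ρ * gs P.L (k - 1)) + P.L := by
  rcases Nat.lt_or_ge j 2 with hj1 | hj2
  · obtain rfl : j = 1 := by omega
    simp
  · -- `m_{j−1} = m_j + ρL^{j−1} ≥ m_j + L^j`, and `m_1 ≥ m_{j−1}`
    obtain ⟨i, rfl⟩ : ∃ i, j = i + 1 := ⟨j - 1, by omega⟩
    have h1 : P.L ^ i * (ρ * gs P.L (k - i)) = P.L ^ (i + 1) * (ρ * gs P.L (k - (i + 1))) + ρ * P.L ^ i :=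
      margin_succ (by omega)
    have h2 : P.L ^ i * (ρ * gs P.L (k - i)) ≤ P.L ^ 1 * (ρ * gs P.L (k - 1)) := margin_anti P.L ρ k 1 i (by omega) (by omega)
    have h3 : P.L ^ (i + 1) ≤ ρ * P.L ^ i := by rw [pow_succ, mul_comm]; exact Nat.mul_le_mul_right _ hLρ
    omega

/-- The collar arithmetic read on the CORNERS of the canonical boxes (`1 ≤ j ≤ k`, `L ≤ ρ`), coordinatewise: `L·(sqLo_1 − 1) ≤ L^j·(sqLo_j − 1)` and
`L^j·(sqHi_j + 1) + (L^j − 1) ≤ L·(sqHi_1 + 1) + (L − 1)`. [cite: Balaban1985RegularSpaces, p.98, (1.131) p.99] -/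
theorem levelBox_zero_corners_le (hLρ : P.L ≤ ρ) {j : ℕ} (hj : 1 ≤ j) (hjk : j ≤ k) (i : Fin P.d) :
    (P.L : ℤ) * (sqLo P.L a ρ k 1 i - 1) ≤ (P.L : ℤ) ^ j * (sqLo P.L a ρ k j i - 1) ∧
    (P.L : ℤ) ^ j * (sqHi P.L a M ρ k j i + 1) + ((P.L : ℤ) ^ j - 1) ≤ (P.L : ℤ) * (sqHi P.L a M ρ k 1 i + 1) + ((P.L : ℤ) - 1) := by
  have hm : ((P.L ^ j * (ρ * gs P.L (k - j)) + P.L ^ j : ℕ) : ℤ) ≤ ((P.L ^ 1 * (ρ * gs P.L (k - 1)) + P.L : ℕ) : ℤ) := by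
    exact_mod_cast margin_add_pow_le_margin_one_add hLρ hj hjk
  have e1 : (P.L : ℤ) * (P.L : ℤ) ^ (k - 1) = (P.L : ℤ) ^ k := by rw [← pow_succ']; congr 1; omega
  have e2 : (P.L : ℤ) ^ j * (P.L : ℤ) ^ (k - j) = (P.L : ℤ) ^ k := by rw [← pow_add]; congr 1; omega
  simp only [sqLo, bLo, sqHi, bHi]
  push_cast at hm ⊢
  have ea : (P.L : ℤ) * ((P.L : ℤ) ^ (k - 1) * a i) = (P.L : ℤ) ^ k * a i := by rw [← mul_assoc, e1]
  have eb : (P.L : ℤ) ^ j * ((P.L : ℤ) ^ (k - j) * a i) = (P.L : ℤ) ^ k * a i := by rw [← mul_assoc, e2]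
  have ec : (P.L : ℤ) * ((P.L : ℤ) ^ (k - 1) * (a i + M)) = (P.L : ℤ) ^ k * (a i + M) := by rw [← mul_assoc, e1]
  have ed : (P.L : ℤ) ^ j * ((P.L : ℤ) ^ (k - j) * (a i + M)) = (P.L : ℤ) ^ k * (a i + M) := by rw [← mul_assoc, e2]
  constructor <;> nlinarith [ea, eb, ec, ed, hm]

/-- ★★★ **THE THREE BOX-MEMBERSHIP BINDERS OF n07-w8's RECORD DOOR, SUPPLIED — for EVERY family `D` levelwise inside the cube family** `cubeDomains P a M ρ k` (the cube
family itself; the meet family `cubeDomains ⊓ …` of a boundary datum), at the CANONICAL LEVEL BOXES `lo_j = sqLo_j − 𝟙`, `hi_j = sqHi_j + 𝟙` (`1 ≤ j`),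
`lo_0 = L·(sqLo_1 − 𝟙)`, `hi_0 = L·(sqHi_1 + 𝟙) + (L − 1)𝟙` (keyed by four equation binders — instantiate e.g. `lo := fun j => if j = 0 then … else …` and discharge them by
`if_pos rfl` ∕ `if_neg`), under the head's standing collar `L ≤ ρ`: (O) outer end-points of `Λ_j`-bonds in `π_j[lo_j, hi_j]`, (S) `Λ_j`-sites (`j ≥ 1`) in `π_j[lo_j, hi_j]`,
(0) fine `Λ₀`-sites under outer end-points in `π[lo_0, hi_0]` — the binder texts `hboxO` ∕ `hboxS` ∕ `hbox0` of
`N07SplitClauseOfShearSize.localGaugeSplitOn_of_gauge152_recordShear_adm22_T4` verbatim (its `Λ₀` hypothesis in (0) is not needed).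
[cite: Balaban1985Variational, (144) p.300, (150) p.301; Balaban1985RegularSpaces, (1.131) p.99, p.98; Balaban1984PropagatorsII, (2.1)–(2.4) p.224; Balaban1984PropagatorsI, (1.18)–(1.20) p.20] -/
theorem levelBoxes_of_Om_subset_cubeDomains (hLρ : P.L ≤ ρ) (D : Domains P) (hD : ∀ j, 1 ≤ j → D.Om j ⊆ (cubeDomains P a M ρ k hk).Om j)
    {lo hi : ℕ → Pt P.d}
    (hlo0 : lo 0 = fun i => (P.L : ℤ) * (sqLo P.L a ρ k 1 i - 1))
    (hhi0 : hi 0 = fun i => (P.L : ℤ) * (sqHi P.L a M ρ k 1 i + 1) + ((P.L : ℤ) - 1))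
    (hloj : ∀ j, 1 ≤ j → lo j = sqLo P.L a ρ k j - 1) (hhij : ∀ j, 1 ≤ j → hi j = sqHi P.L a M ρ k j + 1) :
    (∀ c : BondIdx D,
      (c.1.2.src ∉ D.Om c.1.1 → c.1.2.src ∈ (castSite '' Set.Icc (lo c.1.1) (hi c.1.1) : Set (Site P c.1.1))) ∧
      (c.1.2.tgt ∉ D.Om c.1.1 → c.1.2.tgt ∈ (castSite '' Set.Icc (lo c.1.1) (hi c.1.1) : Set (Site P c.1.1)))) ∧
    (∀ (j : ℕ), 1 ≤ j → ∀ y : Site P j, D.LamSite j y → y ∈ (castSite '' Set.Icc (lo j) (hi j) : Set (Site P j))) ∧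
    (∀ (c : BondIdx D) (x : Site P 0),
      (c.1.2.src ∉ D.Om c.1.1 ∧ iterBlockOf c.1.1 x = c.1.2.src) ∨ (c.1.2.tgt ∉ D.Om c.1.1 ∧ iterBlockOf c.1.1 x = c.1.2.tgt) →
      D.LamSite 0 x → x ∈ (castSite '' Set.Icc (lo 0) (hi 0) : Set (Site P 0))) := by
  have hΩ := Om_boxed_of_subset_cubeDomains D hD
  refine ⟨fun c => ?_, fun j hj y hy => ?_, fun c x hx _ => ?_⟩
  · -- (O)
    have hw := outer_mem_image_widened_of_boxed D hΩ c
    have conv : ∀ {y : Site P c.1.1}, 1 ≤ (c.1.1 : ℕ) →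
        y ∈ (castSite '' Set.Icc (sqLo P.L a ρ k c.1.1 - 1) (sqHi P.L a M ρ k c.1.1 + 1) : Set (Site P c.1.1)) →
        y ∈ (castSite '' Set.Icc (lo c.1.1) (hi c.1.1) : Set (Site P c.1.1)) := by
      intro y hj h; rwa [hloj _ hj, hhij _ hj]
    exact ⟨fun h => conv (one_le_of_not_mem_Om D h) (hw.1 h), fun h => conv (one_le_of_not_mem_Om D h) (hw.2 h)⟩
  · -- (S)
    obtain ⟨s, ⟨hs1, hs2⟩, rfl⟩ := hΩ j hj y hy.1
    rw [hloj j hj, hhij j hj]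
    refine ⟨s, ⟨fun i => ?_, fun i => ?_⟩, rfl⟩
    · have := hs1 i; simp only [Pi.sub_apply, Pi.one_apply]; linarith
    · have := hs2 i; simp only [Pi.add_apply, Pi.one_apply]; linarith
  · -- (0): the level `j` of `c` satisfies `1 ≤ j ≤ k` (its inner end-point lies in `Ω_j^{(j)} ⊆ π_j □_j^{(j)}`); then the collar arithmetic
    have hj : 1 ≤ (c.1.1 : ℕ) := by
      rcases hx with ⟨h, _⟩ | ⟨h, _⟩ <;> exact one_le_of_not_mem_Om D h
    have hjk : (c.1.1 : ℕ) ≤ k := by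
      rcases hx with ⟨h, _⟩ | ⟨h, _⟩
      · exact level_le_of_mem_Om_of_subset_cubeDomains D hD hj (c.2.1.resolve_left h)
      · exact level_le_of_mem_Om_of_subset_cubeDomains D hD hj (c.2.1.resolve_right h)
    refine under_outer_mem_image_of_boxed D hΩ c (fun i => ?_) (fun i => ?_) x hx
    · rw [hlo0]; exact (levelBox_zero_corners_le (M := M) hLρ hj hjk i).1
    · rw [hhi0]; exact (levelBox_zero_corners_le (M := M) hLρ hj hjk i).2

/-- ★★★ **THE THREE BINDERS AT THE CUBE FAMILY ITSELF** (`D := cubeDomains P a M ρ k`, the S6 head's per-datum family at an interior datum; `L ≤ ρ`).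
[cite: Balaban1985Variational, (144) p.300; Balaban1985RegularSpaces, (1.131) p.99, p.98; Balaban1984PropagatorsII, (2.1)–(2.4) p.224; Balaban1984PropagatorsI, (1.18)–(1.20) p.20] -/
theorem levelBoxes_cubeDomains (hLρ : P.L ≤ ρ) {lo hi : ℕ → Pt P.d}
    (hlo0 : lo 0 = fun i => (P.L : ℤ) * (sqLo P.L a ρ k 1 i - 1))
    (hhi0 : hi 0 = fun i => (P.L : ℤ) * (sqHi P.L a M ρ k 1 i + 1) + ((P.L : ℤ) - 1))
    (hloj : ∀ j, 1 ≤ j → lo j = sqLo P.L a ρ k j - 1) (hhij : ∀ j, 1 ≤ j → hi j = sqHi P.L a M ρ k j + 1) :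
    (∀ c : BondIdx (cubeDomains P a M ρ k hk),
      (c.1.2.src ∉ (cubeDomains P a M ρ k hk).Om c.1.1 → c.1.2.src ∈ (castSite '' Set.Icc (lo c.1.1) (hi c.1.1) : Set (Site P c.1.1))) ∧
      (c.1.2.tgt ∉ (cubeDomains P a M ρ k hk).Om c.1.1 → c.1.2.tgt ∈ (castSite '' Set.Icc (lo c.1.1) (hi c.1.1) : Set (Site P c.1.1)))) ∧
    (∀ (j : ℕ), 1 ≤ j → ∀ y : Site P j, (cubeDomains P a M ρ k hk).LamSite j y → y ∈ (castSite '' Set.Icc (lo j) (hi j) : Set (Site P j))) ∧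
    (∀ (c : BondIdx (cubeDomains P a M ρ k hk)) (x : Site P 0),
      (c.1.2.src ∉ (cubeDomains P a M ρ k hk).Om c.1.1 ∧ iterBlockOf c.1.1 x = c.1.2.src) ∨
        (c.1.2.tgt ∉ (cubeDomains P a M ρ k hk).Om c.1.1 ∧ iterBlockOf c.1.1 x = c.1.2.tgt) →
      (cubeDomains P a M ρ k hk).LamSite 0 x → x ∈ (castSite '' Set.Icc (lo 0) (hi 0) : Set (Site P 0))) :=
  levelBoxes_of_Om_subset_cubeDomains hLρ _ (fun _ _ => subset_rfl) hlo0 hhi0 hloj hhij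

/-! ### The widths `D_j = Σ_κ (hi_{j,κ} − lo_{j,κ})` of the canonical boxes (the letter of n07-w8's binder `D_j·(v_j + a_j) ≤ σ`) -/

/-- Width of the canonical level-`j` box, `j ≥ 1`, per coordinate: `(sqHi_j + 1) − (sqLo_j − 1) = L^{k−j}M + 2ρ·gs L (k−j) + 1`.
[cite: Balaban1985RegularSpaces, p.98 («we take a size of □ equal to MLʲη»), (1.131) p.99] -/
theorem toNat_width_levelBox_pos (j : ℕ) (i : Fin P.d) :
    ((sqHi P.L a M ρ k j i + 1) - (sqLo P.L a ρ k j i - 1)).toNat = P.L ^ (k - j) * M + 2 * (ρ * gs P.L (k - j)) + 1 := by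
  have : (sqHi P.L a M ρ k j i + 1) - (sqLo P.L a ρ k j i - 1) = ((P.L ^ (k - j) * M + 2 * (ρ * gs P.L (k - j)) + 1 : ℕ) : ℤ) := by
    simp only [sqHi, sqLo, bHi, bLo]; push_cast; ring
  rw [this, Int.toNat_natCast]

/-- Width of the canonical level-`0` (fine) box per coordinate (`1 ≤ k`): `L·(sqHi_1 + 1) + (L − 1) − L·(sqLo_1 − 1) = L^k M + 2L·ρ·gs L (k−1) + (2L − 1)`.
[cite: Balaban1985RegularSpaces, p.98, (1.131) p.99] -/
theorem toNat_width_levelBox_zero (hk1 : 1 ≤ k) (i : Fin P.d) :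
    (((P.L : ℤ) * (sqHi P.L a M ρ k 1 i + 1) + ((P.L : ℤ) - 1)) - (P.L : ℤ) * (sqLo P.L a ρ k 1 i - 1)).toNat
      = P.L ^ k * M + 2 * (P.L * (ρ * gs P.L (k - 1))) + (2 * P.L - 1) := by
  have e1 : (P.L : ℤ) * (P.L : ℤ) ^ (k - 1) = (P.L : ℤ) ^ k := by rw [← pow_succ']; congr 1; omega
  have : ((P.L : ℤ) * (sqHi P.L a M ρ k 1 i + 1) + ((P.L : ℤ) - 1)) - (P.L : ℤ) * (sqLo P.L a ρ k 1 i - 1)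
      = ((P.L ^ k * M + 2 * (P.L * (ρ * gs P.L (k - 1))) + (2 * P.L - 1) : ℕ) : ℤ) := by
    simp only [sqHi, sqLo, bHi, bLo]
    rw [Nat.cast_add, Nat.cast_sub (by have := P.L_pos; omega : 1 ≤ 2 * P.L)]
    push_cast
    linear_combination (M : ℤ) * e1
  rw [this, Int.toNat_natCast]

/-- ★ **THE WIDTHS ARE `≤ d·(M + 4ρ + 3)·L^{k−j}`** for the canonical boxes, every `j ≤ k` (`1 ≤ k`): `gs L n + 1 ≤ 2Lⁿ` ([6] p. 98 «< (1 − L⁻¹)⁻¹R₁M₁ ≤ 2R₁M₁»,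
`B8Ineq132.geom_margin`) — the level-uniform shape of the lineage's located (166♭) factor once `v_j, a_j` carry `L^{j−k}`.
[cite: Balaban1985RegularSpaces, p.98 (display before (1.128)); Balaban1985Variational, (164)–(166) p.304] -/
theorem width_levelBox_le (hk1 : 1 ≤ k) {lo hi : ℕ → Pt P.d}
    (hlo0 : lo 0 = fun i => (P.L : ℤ) * (sqLo P.L a ρ k 1 i - 1))
    (hhi0 : hi 0 = fun i => (P.L : ℤ) * (sqHi P.L a M ρ k 1 i + 1) + ((P.L : ℤ) - 1))
    (hloj : ∀ j, 1 ≤ j → lo j = sqLo P.L a ρ k j - 1) (hhij : ∀ j, 1 ≤ j → hi j = sqHi P.L a M ρ k j + 1)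
    {j : ℕ} (hjk : j ≤ k) :
    (∑ κ, (hi j κ - lo j κ).toNat) ≤ P.d * ((M + 4 * ρ + 3) * P.L ^ (k - j)) := by
  have hL2 : 2 ≤ P.L := by have := P.hL.2; omega
  rcases Nat.eq_zero_or_pos j with rfl | hj
  · have hw : ∀ κ, (hi 0 κ - lo 0 κ).toNat = P.L ^ k * M + 2 * (P.L * (ρ * gs P.L (k - 1))) + (2 * P.L - 1) := fun κ => by
      rw [hlo0, hhi0]; exact toNat_width_levelBox_zero hk1 κ
    simp only [hw, Finset.sum_const, Finset.card_univ, Fintype.card_fin, smul_eq_mul, Nat.sub_zero]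
    refine Nat.mul_le_mul_left _ ?_
    have hg : gs P.L (k - 1) + 1 ≤ 2 * P.L ^ (k - 1) := geom_margin hL2 (k - 1)
    have e1 : P.L * P.L ^ (k - 1) = P.L ^ k := by rw [← pow_succ']; congr 1; omega
    have hLk : P.L ≤ P.L ^ k := by
      calc P.L = P.L ^ 1 := (pow_one _).symm
        _ ≤ P.L ^ k := Nat.pow_le_pow_right P.L_pos hk1
    have h1 : 2 * (P.L * (ρ * gs P.L (k - 1))) + 2 * (P.L * ρ) ≤ 4 * ρ * P.L ^ k := by
      have := Nat.mul_le_mul_left (2 * P.L * ρ) hg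
      rw [← e1]; nlinarith
    have expand : (M + 4 * ρ + 3) * P.L ^ k = P.L ^ k * M + 4 * ρ * P.L ^ k + 3 * P.L ^ k := by ring
    rw [expand]
    omega
  · have hw : ∀ κ, (hi j κ - lo j κ).toNat = P.L ^ (k - j) * M + 2 * (ρ * gs P.L (k - j)) + 1 := fun κ => by
      rw [hloj j hj, hhij j hj]; exact toNat_width_levelBox_pos j κ
    simp only [hw, Finset.sum_const, Finset.card_univ, Fintype.card_fin, smul_eq_mul]
    refine Nat.mul_le_mul_left _ ?_
    have hg : gs P.L (k - j) + 1 ≤ 2 * P.L ^ (k - j) := geom_margin hL2 (k - j)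
    have h1 : 2 * (ρ * gs P.L (k - j)) + 2 * ρ ≤ 4 * ρ * P.L ^ (k - j) := by
      have := Nat.mul_le_mul_left (2 * ρ) hg
      nlinarith
    have hLk : 1 ≤ P.L ^ (k - j) := Nat.one_le_pow _ _ P.L_pos
    nlinarith

end Cube

end Summit.QuantumFields.YangMills.BalabanUVNodes.N07SplitClauseBoxesCubeDomains

end
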